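import Mathlib.Analysis.Calculus.IteratedDeriv.Defs
import Mathlib.Analysis.Calculus.ContDiff.Defs
import Mathlib.Analysis.SpecialFunctions.Pow.Real
import Mathlib.MeasureTheory.Integral.Bochner.Basic
import Mathlib.MeasureTheory.Measure.Lebesgue.Basic
import Mathlib.Analysis.SpecialFunctions.Exp
import HarnessLib

/-!
# Stationary phase with uniformity in parameters («X-inert» weights): Kıral–Petrow–Young 2019 — NAMED FACTS

Topic `Literature/Analysis/Fourier`.  STATEMENT-ONLY typing (named facts, not proved here) of
Kıral–Petrow–Young, *Oscillatory integrals with uniformity in parameters*, JTNB 31 (2019) = arXiv:1710.00916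
[KiralPetrowYoung2019]: Definition 2.1 (`X`-inert families), Lemma 3.1 (= Blomer–Khan–Young 2013, Lemma 8.1 and
Proposition 8.2, restated: the one-variable non-stationary and stationary-phase estimates with error `O_A(Z R^{-A})`)
and the Main Theorem (p. 5) in the TWO-variable case `d = 2` (stationary phase in `t₁` whose output weight is again
`X`-inert in `t₂` — the closure property that lets one ITERATE).  The tree already PROVES the Titchmarsh-quality
statements (`stationaryPhase`, `weightedStationaryPhase_sharp`: error `λ₂^{-4/5}λ₃^{1/5}`-type) and the linear-phase
non-stationary decay (`norm_integral_dyadicWindow_mul_mul_cexp_le`); what is typed here is the arbitrary-`A` decay and the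
inert closure, which those do not give.

TYPING CONVENTIONS (faithful to the paper's «Convention», p. 3: implied constants depend only on the inert constants
`C_𝓕` and on `A`).  A family is replaced by ONE instance obeying derivative bounds with a FIXED constant table, and the
tables are quantified BEFORE the instance: `∀ (tables) (A), ∃ K, ∀ (instance obeying the tables), … ≤ K · Z · R^{-A}`.
«Supported on `t ≍ Z`» is read as support in the dyadic interval `[Z, 2Z]` (Def. 2.1: «a product of dyadic intervals»);
«`φ'' ≫ Y/Z²`» as `φ'' ≥ c·Y/Z²` with `c > 0` part of the tables; derivatives are `iteratedDeriv`, mixed partials in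
`d = 2` are iterated one-variable derivatives (`mixedDeriv`; the functions are `C^∞`).  Where the print leaves a range
implicit we take the STRONGER hypothesis (all orders `j`, including the size bound `|φ| ≪ Y` of (3.1) at `a = 0`), so each
`def` below is implied by the printed statement.  `-- TODO(general form)`: the Main Theorem for all `d` and the explicit
leading coefficient of `W_T` (BKY Prop. 8.2's expansion) are not typed.

HONESTY: typed ≠ proved; these are hypotheses to be cited by name (`(h : kpy2019_mainTheorem_two)`), never asserted.

ERRATUM (ED. 2, 2026-09-04; bodies byte-unchanged).  «Smooth» is typed below as `ContDiff ℝ ⊤`.  In Mathlib's exponent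
type `ℕ∞ω = WithTop ℕ∞` the element `⊤` is `ω` = ANALYTIC (`contDiff_omega_iff_analyticOnNhd`); `C^∞` is
`((⊤ : ℕ∞) : ℕ∞ω)`, written `∞` under `open scoped ContDiff`.  Consequently `InertOn C X Z w` / `InertOn₂ C X Z X₂ w`
(analytic AND vanishing off the dyadic box) force `w = 0` by the identity principle (PROVED: `InertOn.eq_zero`,
`InertOn₂.eq_zero` in `Literature/Analysis/Fourier/StationaryPhaseInertHolds.lean`), and the three named facts
`kpy2019_lemma31_nonstationary`, `kpy2019_lemma31_stationary`, `kpy2019_mainTheorem_two` are VACUOUS AS TYPED — they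
hold with `K = 0`, `F = W = 0` and are discharged in that file (`…_holds`); they carry NO analytic content and must not
be cited as the printed results.  The FAITHFUL smooth letter of Lemma 3.1 (1) (= [BKY2013, Lemma 8.1]) is PROVED as
the theorem `norm_oscInt_le_of_nonstationary` in `Literature/Analysis/Fourier/StationaryPhaseInertNonstationary.lean`
(same binders as `kpy2019_lemma31_nonstationary`, «smooth» = `ContDiff ℝ ∞`).  The faithful smooth letters of
Lemma 3.1 (2) and of the Main Theorem are NOT typed in the tree: re-typing them means replacing `ContDiff ℝ ⊤` by
`ContDiff ℝ ∞` in `InertOn`, `InertOn₂`, `InertOut` and in the two facts, under NEW primed names (each an unproved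
named fact until BKY Prop. 8.2 / the KPY Main Theorem is formalised) — a typer-desk decision, not done in this edition.

## References
* [KiralPetrowYoung2019] E. M. Kıral, I. Petrow, M. P. Young, *Oscillatory integrals with uniformity in parameters*,
  J. Théor. Nombres Bordeaux 31 (2019) 145–159, Def. 2.1, Lemma 3.1, Main Theorem (§3).
-/

noncomputable section

open MeasureTheory Set

namespace Literature.Analysis.Fourier

namespace InertStationaryPhase

/-! ### Inert derivative bounds (Definition 2.1, one and two variables) -/

/-- ONE-VARIABLE `X`-INERT BOUND with constant table `C` on the dyadic interval `[Z, 2Z]`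
(KPY Def. 2.1 with `d = 1`, as used in Lemma 3.1: `w^{(j)}(t) ≪ (Z/X)^{-j}`): `w` is smooth, vanishes off `[Z, 2Z]`,
and `‖w^{(j)}(t)‖ ≤ C(j)·(X/Z)^j` for all `j` and `t`.  ERRATUM (ED. 2): `ContDiff ℝ ⊤` is `C^ω` (analytic), so this
predicate forces `w = 0` (`InertOn.eq_zero`); the printed definition asks `C^∞` (`ContDiff ℝ ∞`).
[cite: KiralPetrowYoung2019, Definition 2.1] -/
def InertOn (C : ℕ → ℝ) (X Z : ℝ) (w : ℝ → ℂ) : Prop :=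
  ContDiff ℝ ⊤ w ∧ (∀ t, t ∉ Icc Z (2 * Z) → w t = 0) ∧
    ∀ (j : ℕ) (t : ℝ), ‖iteratedDeriv j w t‖ ≤ C j * (X / Z) ^ j

/-- Mixed partial derivative `∂₁^{j₁} ∂₂^{j₂} w (t₁, t₂)` of a two-variable function, as iterated one-variable
derivatives (for the `C^∞` functions below the order is immaterial). [cite: KiralPetrowYoung2019, Definition 2.1] -/
def mixedDeriv (j₁ j₂ : ℕ) (w : ℝ → ℝ → ℂ) (t₁ t₂ : ℝ) : ℂ :=
  iteratedDeriv j₁ (fun s => iteratedDeriv j₂ (w s) t₂) t₁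

/-- Real-valued version of `mixedDeriv` (for phases). [cite: KiralPetrowYoung2019, Definition 2.1] -/
def mixedDerivReal (j₁ j₂ : ℕ) (φ : ℝ → ℝ → ℝ) (t₁ t₂ : ℝ) : ℝ :=
  iteratedDeriv j₁ (fun s => iteratedDeriv j₂ (φ s) t₂) t₁

/-- TWO-VARIABLE `X`-INERT BOUND with constant table `C` on the dyadic box `[Z, 2Z] × [X₂, 2X₂]` (KPY Def. 2.1, `d = 2`):
`w` is jointly smooth, vanishes off the box, and `|t₁^{j₁} t₂^{j₂} ∂^{(j₁,j₂)} w| ≤ C(j₁,j₂)·X^{j₁+j₂}` on the box.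
ERRATUM (ED. 2): `ContDiff ℝ ⊤` is `C^ω`, so this predicate forces `w = 0` (`InertOn₂.eq_zero`); the print asks `C^∞`.
[cite: KiralPetrowYoung2019, Definition 2.1] -/
def InertOn₂ (C : ℕ → ℕ → ℝ) (X Z X₂ : ℝ) (w : ℝ → ℝ → ℂ) : Prop :=
  ContDiff ℝ ⊤ (Function.uncurry w) ∧
    (∀ t₁ t₂, (t₁ ∉ Icc Z (2 * Z) ∨ t₂ ∉ Icc X₂ (2 * X₂)) → w t₁ t₂ = 0) ∧
    ∀ (j₁ j₂ : ℕ) (t₁ t₂ : ℝ), t₁ ∈ Icc Z (2 * Z) → t₂ ∈ Icc X₂ (2 * X₂) →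
      ‖((t₁ ^ j₁ * t₂ ^ j₂ : ℝ) : ℂ) * mixedDeriv j₁ j₂ w t₁ t₂‖ ≤ C j₁ j₂ * X ^ (j₁ + j₂)

/-- ONE-VARIABLE `X`-inert bound in the SECOND variable on `[X₂, 2X₂]` for the output weight of the Main Theorem:
smooth, `|t₂^{j} W^{(j)}(t₂)| ≤ C(j)·X^{j}` on `[X₂, 2X₂]`.  ERRATUM (ED. 2): `ContDiff ℝ ⊤` is `C^ω` (stronger than the
printed `C^∞`; as a CONCLUSION it over-claims analyticity of the output weight). [cite: KiralPetrowYoung2019, Definition 2.1] -/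
def InertOut (C : ℕ → ℝ) (X X₂ : ℝ) (W : ℝ → ℂ) : Prop :=
  ContDiff ℝ ⊤ W ∧ ∀ (j : ℕ) (t₂ : ℝ), t₂ ∈ Icc X₂ (2 * X₂) →
    ‖((t₂ ^ j : ℝ) : ℂ) * iteratedDeriv j W t₂‖ ≤ C j * X ^ j

/-- The oscillatory integral `I = ∫_ℝ w(t) e^{iφ(t)} dt`. [cite: KiralPetrowYoung2019, Lemma 3.1] -/
def oscInt (w : ℝ → ℂ) (φ : ℝ → ℝ) : ℂ := ∫ t : ℝ, w t * Complex.exp (Complex.I * φ t)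

/-- The `t₁`-integral `I(t₂) = ∫_ℝ w(t₁, t₂) e^{iφ(t₁, t₂)} dt₁` of the Main Theorem (`d = 2`).
[cite: KiralPetrowYoung2019, Main Theorem (3.2)] -/
def oscInt₂ (w : ℝ → ℝ → ℂ) (φ : ℝ → ℝ → ℝ) (t₂ : ℝ) : ℂ :=
  ∫ t₁ : ℝ, w t₁ t₂ * Complex.exp (Complex.I * φ t₁ t₂)

/-! ### Lemma 3.1 ([BKY] Lemma 8.1 / Proposition 8.2), one variable -/

/-- NAMED FACT — **KPY Lemma 3.1, first bullet (non-stationary phase, arbitrary decay).**  «Suppose that `w = w_T(t)` is a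
family of `X`-inert functions with compact support on `[Z, 2Z]`, so that `w^{(j)}(t) ≪ (Z/X)^{-j}`.  Also suppose that `φ`
is smooth and satisfies `φ^{(j)}(t) ≪ Y/Z^j` for some `Y/X² ≥ R ≥ 1` and all `t` in the support of `w`.  If
`|φ'(t)| ≫ Y/Z` for all `t` in the support of `w`, then `I ≪_A Z R^{-A}` for `A` arbitrarily large» (the paper adds that this
bullet only needs `Y/X ≥ R`; we keep `Y/X² ≥ R`).  Typed with the phase bounds for all `j ≥ 1` on `[Z, 2Z]` and constants
`K = K(C_w, C_φ, c, A)`.  ERRATUM (ED. 2): VACUOUS AS TYPED (`InertOn` forces `w = 0`; discharged with `K = 0` by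
`kpy2019_lemma31_nonstationary_holds`); the faithful `C^∞` letter is PROVED as `norm_oscInt_le_of_nonstationary`
(`StationaryPhaseInertNonstationary.lean`). [cite: KiralPetrowYoung2019, Lemma 3.1 (1)] -/
def kpy2019_lemma31_nonstationary : Prop :=
  ∀ (Cw Cφ : ℕ → ℝ) (c : ℝ), 0 < c → ∀ A : ℝ, 0 ≤ A → ∃ K : ℝ,
    ∀ (w : ℝ → ℂ) (φ : ℝ → ℝ) (Z X Y R : ℝ), 0 < Z → 1 ≤ X → 0 < Y → 1 ≤ R → R ≤ Y / X ^ 2 →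
      InertOn Cw X Z w → ContDiff ℝ ⊤ φ →
      (∀ j : ℕ, 1 ≤ j → ∀ t ∈ Icc Z (2 * Z), |iteratedDeriv j φ t| ≤ Cφ j * Y / Z ^ j) →
      (∀ t ∈ Icc Z (2 * Z), c * Y / Z ≤ |deriv φ t|) →
        ‖oscInt w φ‖ ≤ K * Z * R ^ (-A)

/-- NAMED FACT — **KPY Lemma 3.1, second bullet (stationary phase with inert output).**  «If `φ''(t) ≫ Y/Z²` for all `t` in
the support of `w`, and there exists `t₀ ∈ ℝ` such that `φ'(t₀) = 0` (note `t₀` is necessarily unique), then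
`I = e^{iφ(t₀)} F_T(t₀)/√(φ''(t₀)) + O_A(Z R^{-A})`, where `F_T` is a family of `X`-inert functions (depending on `A`)
supported on `t₀ ≍ Z`.»  Typed for ONE instance, with the stationary point taken INSIDE the dyadic interval
(`t₀ ∈ [Z, 2Z]`; stronger hypothesis than the print's `t₀ ∈ ℝ` — `-- TODO(general form)`): the output `F` obeys the
one-variable inert bounds with a table `C_F` depending only on `(C_w, C_φ, c, A)` (the paper's own caveat, p. 5: realising
`F_T` as inert in auxiliary variables needs the Main Theorem; this bullet is recorded as printed).
ERRATUM (ED. 2): VACUOUS AS TYPED (`InertOn` forces `w = 0`, and `ContDiff ℝ ⊤ φ`, `ContDiff ℝ ⊤ F` are `C^ω`; discharged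
with `K = 0`, `F = 0` by `kpy2019_lemma31_stationary_holds`); the faithful `C^∞` letter (= BKY Prop. 8.2) is NOT typed.
[cite: KiralPetrowYoung2019, Lemma 3.1 (2)] -/
def kpy2019_lemma31_stationary : Prop :=
  ∀ (Cw Cφ : ℕ → ℝ) (c : ℝ), 0 < c → ∀ A : ℝ, 0 ≤ A → ∃ (K : ℝ) (CF : ℕ → ℝ),
    ∀ (w : ℝ → ℂ) (φ : ℝ → ℝ) (Z X Y R t₀ : ℝ), 0 < Z → 1 ≤ X → 0 < Y → 1 ≤ R → R ≤ Y / X ^ 2 →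
      InertOn Cw X Z w → ContDiff ℝ ⊤ φ →
      (∀ j : ℕ, 1 ≤ j → ∀ t ∈ Icc Z (2 * Z), |iteratedDeriv j φ t| ≤ Cφ j * Y / Z ^ j) →
      (∀ t ∈ Icc Z (2 * Z), c * Y / Z ^ 2 ≤ iteratedDeriv 2 φ t) →
      t₀ ∈ Icc Z (2 * Z) → deriv φ t₀ = 0 →
        ∃ F : ℝ → ℂ, ContDiff ℝ ⊤ F ∧ (∀ (j : ℕ) (t : ℝ), ‖iteratedDeriv j F t‖ ≤ CF j * (X / Z) ^ j) ∧
          ‖oscInt w φ - Complex.exp (Complex.I * φ t₀) * F t₀ * (((Real.sqrt (iteratedDeriv 2 φ t₀))⁻¹ : ℝ) : ℂ)‖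
            ≤ K * Z * R ^ (-A)

/-! ### The Main Theorem, two variables (`d = 2`) -/

/-- NAMED FACT — **KPY Main Theorem (stationary phase), case `d = 2`.**  «Suppose `w_T` is `X`-inert in `t₁, t₂`, supported on
`t₁ ≍ Z` and `t₂ ≍ X₂`.  Suppose that on the support of `w_T`, `φ = φ_T` satisfies
`∂^{a₁+a₂}φ/∂t₁^{a₁}∂t₂^{a₂} ≪_{C_𝓕} (Y/Z^{a₁})·(1/X₂^{a₂})` for all `a₁, a₂ ∈ ℕ`.  Suppose `φ'' ≫ Y/Z²` (derivative in
`t₁`) on the support of `w_T`, and there exists `t₀ ∈ ℝ` such that `φ'(t₀) = 0` (necessarily unique).  Suppose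
`Y/X² ≥ R ≥ 1`.  Then `I = ∫ e^{iφ(t₁,t₂)} w_T(t₁,t₂) dt₁ = (Z/√Y)·e^{iφ(t₀,t₂)}·W_T(t₂) + O_A(Z R^{-A})` for some `X`-inert
family of functions `W_T`, where `A > 0` may be taken arbitrarily large; the implied constant depends only on `A` and
`C_𝓕`.»  Typed: the stationary point is a function `t₀(t₂) ∈ [Z, 2Z]` (inside the dyadic interval — stronger than the print's
`t₀ ∈ ℝ`, `-- TODO(general form)`) with `∂₁φ(t₀(t₂), t₂) = 0` for `t₂ ∈ [X₂, 2X₂]`; the output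
`W` obeys the inert bounds in `t₂` on `[X₂, 2X₂]` with a table `C_W = C_W(C_w, C_φ, c, A)`; the asymptotic holds for every
`t₂ ∈ [X₂, 2X₂]`.  ERRATUM (ED. 2): VACUOUS AS TYPED (`InertOn₂` forces `w = 0`; `ContDiff ℝ ⊤` is `C^ω` throughout;
discharged with `K = 0`, `W = 0` by `kpy2019_mainTheorem_two_holds`); the faithful `C^∞` letter is NOT typed.
[cite: KiralPetrowYoung2019, Main Theorem (§3, (3.1)–(3.2))] -/
def kpy2019_mainTheorem_two : Prop :=
  ∀ (Cw Cφ : ℕ → ℕ → ℝ) (c : ℝ), 0 < c → ∀ A : ℝ, 0 ≤ A → ∃ (K : ℝ) (CW : ℕ → ℝ),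
    ∀ (w : ℝ → ℝ → ℂ) (φ : ℝ → ℝ → ℝ) (t₀ : ℝ → ℝ) (Z X X₂ Y R : ℝ),
      0 < Z → 1 ≤ X → 0 < X₂ → 0 < Y → 1 ≤ R → R ≤ Y / X ^ 2 →
      InertOn₂ Cw X Z X₂ w → ContDiff ℝ ⊤ (Function.uncurry φ) →
      (∀ (a₁ a₂ : ℕ) (t₁ t₂ : ℝ), t₁ ∈ Icc Z (2 * Z) → t₂ ∈ Icc X₂ (2 * X₂) →
          |mixedDerivReal a₁ a₂ φ t₁ t₂| ≤ Cφ a₁ a₂ * Y / (Z ^ a₁ * X₂ ^ a₂)) →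
      (∀ (t₁ t₂ : ℝ), t₁ ∈ Icc Z (2 * Z) → t₂ ∈ Icc X₂ (2 * X₂) →
          c * Y / Z ^ 2 ≤ mixedDerivReal 2 0 φ t₁ t₂) →
      (∀ t₂ ∈ Icc X₂ (2 * X₂), t₀ t₂ ∈ Icc Z (2 * Z) ∧ mixedDerivReal 1 0 φ (t₀ t₂) t₂ = 0) →
        ∃ W : ℝ → ℂ, InertOut CW X X₂ W ∧
          ∀ t₂ ∈ Icc X₂ (2 * X₂),
            ‖oscInt₂ w φ t₂ - ((Z / Real.sqrt Y : ℝ) : ℂ) * Complex.exp (Complex.I * φ (t₀ t₂) t₂) * W t₂‖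
              ≤ K * Z * R ^ (-A)

end InertStationaryPhase

end Literature.Analysis.Fourier
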